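import Summits.AtomisticToContinuum.Crystallization.Theorems.OverbindingBudgetAffineRadialReductionA

/-!
# Radial (extremal) reduction of the far-core certificate table (slot Z, leaf Z2) — part 2 of 2 (sequel of `…OverbindingBudgetAffineRadialReductionA`)

Split for the 400-line cap by the landing lane (hand-2 g33); the module docstring of part 1 (`…OverbindingBudgetAffineRadialReductionA`) describes the whole node.  Same namespace; all FQNs unchanged.
0 sorry; standard axioms.
-/

open Set Filter Topology

namespace Summit.AtomisticToContinuum.Crystallization.Theorems.OverbindingBudgetAffineRadialReduction

/-! ## §4 Sanity instance and the dictionary to the Z2 table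

A one-dimensional toy (`ψ y = y²`, centre `0`, `m₀ = 2`, `η = δ₀ = 0`, `b = r₁²`) shows the hypotheses
are jointly satisfiable and the conclusion is the expected one (`y² ≥ r₁²` for `|y| ≥ r₁`).

DICTIONARY (for the kernel file; not formalised here).  `E = Fin 5 → ℝ` (or `EuclideanSpace ℝ (Fin 5)`):
the offsets `(a₀₁, a₀₂, a₁₁, a₁₂, a₂₂)` of the pinned Gram matrix `G = G_c + Σ xᵢ Eᵢ` (`a₀₀ = 1`);
`x₀ = ` the class centre (perfect `hcp`/`dhcp`/… Gram point at the reference `c/a`);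
`K = ` the image of the admissible far windows under the chart (g67 (K5) `farWindowData_chart`),
intersected with the anisotropy cap `λ_max(G₀⁻¹G) ≤ (28/25)²/(22/25)² · λ_min` — convex, contains `x₀`;
`ψ x = (T₆fin(x) + F₁₂⁻) / (T₃fin(x) + F₆⁺)²` with `T_m fin(x) = Σ_{v ∈ 𝓥} s_v(x)^{-m}`,
`s_v(x) = vᵀ G(x) v = c_v + ℓ_v · (x − x_c)` affine in `x`, and the landed far-field constants;
`ψ₁ y u = (T₆' (T₃+F) − 2 (T₆+F') T₃') / (T₃+F)³`, `ψ₂ y u = ` the corresponding quotient-rule expression,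
where along the line `y + t u`: `T_m' = −m Σ_v (ℓ_v·u) s_v^{−m−1}`, `T_m'' = m(m+1) Σ_v (ℓ_v·u)² s_v^{−m−2}`
— weighted family sums of exactly the kernel's `acc` type with exponents `4, 5, 7, 8`;
`b = L6hi / (l3² − 24κ″ L6hi)`; `r₁` = the Gram-distance excluded by the far clause (the (N♯) row);
`δ₀ = b − ψ x₀ ≈ 4·10⁻⁹`, `η = |∂_{c/a} ψ (x₀)|` (zero in the four symmetric directions), `m₀ ≈ 0.08`
(numerical `λ_min ∇²ψ(x₀)`), `ρ ≈ 0.02–0.05`, `ρ₁ ≈ 0.15–0.2` (beyond it the g67 value rows are as large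
as derivative rows).  Table (B) = kernel rows certifying `0 < E₁ ∨ 0 < E₂` on cells (each cell picks one
disjunct); table (C) = one `LDLᵀ` row for the interval Hessian on the centre ball; (G) = a point
evaluation.  Numerical status (g68 memo §2): (B) holds on the whole admissible region of the
`(6,·)` classes with normalised margin `≥ 0.6` (adversarial search), the radial curvature of `ψ` is
`≥ 0.1` for `‖x − x₀‖ ≤ 0.15` in all sampled directions and dips to `−0.03` only at maximal-anisotropy
corners near `‖x − x₀‖ ≈ 0.22`, where the radial slope is `≈ +0.026`. -/

section Toy

/-- Toy instance of `radial_reduction` on `E = ℝ`: `ψ y = y ^ 2`, centre `0`, `m₀ = 2`, `η = 0`,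
`δ₀ = b = r₁ ^ 2`, `ρ = r₁`; conclusion `r₁ ^ 2 ≤ x ^ 2` for `r₁ ≤ |x|`. -/
example (r₁ : ℝ) (hr₁ : 0 < r₁) : ∀ x ∈ (univ : Set ℝ), r₁ ≤ ‖x - 0‖ → r₁ ^ 2 ≤ x ^ 2 := by
  have hlin : ∀ y u : ℝ, HasDerivAt (fun t : ℝ => y + t * u) u 0 := by
    intro y u
    simpa using ((hasDerivAt_id (0 : ℝ)).mul_const u).const_add y
  have hd1 : ∀ y ∈ (univ : Set ℝ), ∀ u : ℝ,
      HasDerivAt (fun t : ℝ => (y + t • u) ^ 2) (2 * y * u) 0 := by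
    intro y _ u
    have h2 := (hlin y u).pow 2
    refine h2.congr_deriv ?_
    simp
  have hd2 : ∀ y ∈ (univ : Set ℝ), ∀ u : ℝ,
      HasDerivAt (fun t : ℝ => 2 * (y + t • u) * u) (2 * u ^ 2) 0 := by
    intro y _ u
    exact (((hlin y u).const_mul 2).mul_const u).congr_deriv (by ring)
  refine radial_reduction (ψ := fun y : ℝ => y ^ 2) (ψ₁ := fun y u : ℝ => 2 * y * u)
    (ψ₂ := fun _ u : ℝ => 2 * u ^ 2) (K := univ) (x₀ := 0) (ρ := r₁) (m₀ := 2) (η := 0)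
    (δ₀ := r₁ ^ 2) (b := r₁ ^ 2) (r₁ := r₁) (convex_univ.starConvex (mem_univ _)) hd1 hd2
    ?_ ?_ ?_ ?_ hr₁ le_rfl ?_ ?_
  · -- (C): `2 ≤ 2 u²` for a unit direction
    intro y _ _ u hu
    rw [Real.norm_eq_abs] at hu
    have : u ^ 2 = 1 := by rw [← sq_abs, hu, one_pow]
    rw [this]; norm_num
  · -- (B): the radial slope `2 y · (y/|y|)` is positive away from the centre
    intro y _ hy
    left
    rw [sub_zero] at hy ⊢
    have hy0 : 0 < |y| := by rw [← Real.norm_eq_abs]; exact hr₁.trans_le hy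
    have hyne : y ≠ 0 := abs_pos.mp hy0
    rw [smul_eq_mul, Real.norm_eq_abs]
    have : 2 * y * (|y|⁻¹ * y) = 2 * (y * y) / |y| := by ring
    rw [this]
    exact div_pos (by have := mul_self_pos.2 hyne; linarith) hy0
  · intro u _; simp
  · simp
  · intro t ht; nlinarith [ht.1]
  · linarith

end Toy

/-! ## §5 The dictionary made formal: radial derivative fields of an inverse-power family quotient

For the kernel: the line derivatives of `S_{k+1}(y) = Σ_{i ∈ s} (c_i + L_i y)^{-(k+1)}` (`L_i` linear) and
of the quotient `ψ = (S₆ + F₆) / (S₃ + F₃)²` are the explicit weighted family sums `dS`, `ddS` below and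
the quotient-rule expressions `psi₁`, `psi₂`; `hasDerivAt_psi_line` / `hasDerivAt_psi₁_line` are exactly
the hypotheses `hd1` / `hd2` of `radial_reduction` for this `ψ`.  (`E` is any real vector space: the five
pinned Gram coordinates in the application, `c_i = vᵢᵀ G_c vᵢ`, `L_i x = vᵢᵀ (Σ_j x_j E_j) vᵢ`.) -/

noncomputable section FamilySums

/-- Line derivative of one inverse-power term `t ↦ (a + t b)^{-(k+1)}` at `t = 0`. -/
theorem hasDerivAt_inv_pow_affine (a b : ℝ) (k : ℕ) (ha : a ≠ 0) :
    HasDerivAt (fun t : ℝ => ((a + t * b) ^ (k + 1))⁻¹)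
      (-((k + 1 : ℕ) : ℝ) * b * (a ^ (k + 2))⁻¹) 0 := by
  have h1 : HasDerivAt (fun t : ℝ => a + t * b) b 0 := by
    simpa using ((hasDerivAt_id (0 : ℝ)).mul_const b).const_add a
  have h2 := h1.pow (k + 1)
  have h0 : a + 0 * b = a := by ring
  have h3 := h2.inv (by simp only [Pi.pow_apply, h0]; exact pow_ne_zero _ ha)
  refine h3.congr_deriv ?_
  simp only [Pi.pow_apply, h0, Nat.add_sub_cancel]
  field_simp
  ring

variable {E : Type*} [AddCommGroup E] [Module ℝ E] {ι : Type*}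

/-- The data of an inverse-power family on the chart: index set, centres `c_i`, linear parts `L_i`, and the
two far-field constants (`F₃` added to the cube sum — an UPPER enclosure of the omitted tail of `T₃↑`,
`F₆` added to the sixth-power sum — a LOWER enclosure of the omitted tail of `T₆↓`). -/
structure FamilyData (E : Type*) [AddCommGroup E] [Module ℝ E] (ι : Type*) where
  s : Finset ι
  c : ι → ℝ
  L : ι → E →ₗ[ℝ] ℝ
  F₃ : ℝ
  F₆ : ℝ

variable (D : FamilyData E ι)

/-- `S_{k+1}(y) = Σ_i (c_i + L_i y)^{-(k+1)}`. -/
def FamilyData.S (k : ℕ) (y : E) : ℝ := ∑ i ∈ D.s, ((D.c i + D.L i y) ^ (k + 1))⁻¹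

/-- First line derivative of `S_{k+1}` at `y` in direction `u`. -/
def FamilyData.dS (k : ℕ) (y u : E) : ℝ :=
  ∑ i ∈ D.s, -((k + 1 : ℕ) : ℝ) * D.L i u * ((D.c i + D.L i y) ^ (k + 2))⁻¹

/-- Second line derivative of `S_{k+1}` at `y` in direction `u`. -/
def FamilyData.ddS (k : ℕ) (y u : E) : ℝ :=
  ∑ i ∈ D.s, ((k + 1 : ℕ) : ℝ) * ((k + 2 : ℕ) : ℝ) * (D.L i u) ^ 2 * ((D.c i + D.L i y) ^ (k + 3))⁻¹

/-- `P = S₃ + F₃` (the enclosed `T₃↑`). -/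
def FamilyData.P (y : E) : ℝ := D.S 2 y + D.F₃
/-- `N = S₆ + F₆` (the enclosed `T₆↓`). -/
def FamilyData.N (y : E) : ℝ := D.S 5 y + D.F₆
/-- `ψ = N / P²`. -/
def FamilyData.psi (y : E) : ℝ := D.N y / D.P y ^ 2
/-- Radial slope field `ψ₁`. -/
def FamilyData.psi₁ (y u : E) : ℝ := D.dS 5 y u / D.P y ^ 2 - 2 * D.N y * D.dS 2 y u / D.P y ^ 3
/-- Radial curvature field `ψ₂`. -/
def FamilyData.psi₂ (y u : E) : ℝ :=
  D.ddS 5 y u / D.P y ^ 2 - 4 * D.dS 5 y u * D.dS 2 y u / D.P y ^ 3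
    - 2 * D.N y * D.ddS 2 y u / D.P y ^ 3 + 6 * D.N y * D.dS 2 y u ^ 2 / D.P y ^ 4

/-- Along the line `y + t u` each family denominator is affine in `t`: `c_i + L_i (y + t u) = (c_i + L_i y) + t · L_i u`
(docstring added by the landing lane). [formal bookkeeping] -/
theorem FamilyData.affine_line (i : ι) (y u : E) (t : ℝ) :
    D.c i + D.L i (y + t • u) = (D.c i + D.L i y) + t * D.L i u := by
  simp only [map_add, map_smul, smul_eq_mul]; ring

/-- `t ↦ S_{k+1}(y + t u)` has derivative `dS` at `0`. -/
theorem FamilyData.hasDerivAt_S_line (k : ℕ) (y u : E) (hpos : ∀ i ∈ D.s, D.c i + D.L i y ≠ 0) :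
    HasDerivAt (fun t : ℝ => D.S k (y + t • u)) (D.dS k y u) 0 := by
  unfold FamilyData.S FamilyData.dS
  apply HasDerivAt.fun_sum
  intro i hi
  have hfun : (fun t : ℝ => ((D.c i + D.L i (y + t • u)) ^ (k + 1))⁻¹)
      = fun t : ℝ => (((D.c i + D.L i y) + t * D.L i u) ^ (k + 1))⁻¹ := by
    funext t; rw [D.affine_line]
  rw [hfun]
  exact hasDerivAt_inv_pow_affine _ _ k (hpos i hi)

/-- `t ↦ dS_{k+1}(y + t u, u)` has derivative `ddS` at `0`. -/
theorem FamilyData.hasDerivAt_dS_line (k : ℕ) (y u : E) (hpos : ∀ i ∈ D.s, D.c i + D.L i y ≠ 0) :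
    HasDerivAt (fun t : ℝ => D.dS k (y + t • u) u) (D.ddS k y u) 0 := by
  unfold FamilyData.dS FamilyData.ddS
  apply HasDerivAt.fun_sum
  intro i hi
  have hfun : (fun t : ℝ => -((k + 1 : ℕ) : ℝ) * D.L i u * ((D.c i + D.L i (y + t • u)) ^ (k + 2))⁻¹)
      = fun t : ℝ => -((k + 1 : ℕ) : ℝ) * D.L i u * ((((D.c i + D.L i y) + t * D.L i u) ^ (k + 1 + 1))⁻¹) := by
    funext t; rw [D.affine_line]
  rw [hfun]
  have h := (hasDerivAt_inv_pow_affine (D.c i + D.L i y) (D.L i u) (k + 1) (hpos i hi)).const_mul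
    (-((k + 1 : ℕ) : ℝ) * D.L i u)
  refine h.congr_deriv ?_
  push_cast
  ring

/-- Quotient rule, shape `N / P²`. -/
theorem hasDerivAt_quot_sq {N P : ℝ → ℝ} {N' P' x : ℝ} (hN : HasDerivAt N N' x) (hP : HasDerivAt P P' x)
    (hP0 : P x ≠ 0) :
    HasDerivAt (fun t => N t / P t ^ 2) (N' / P x ^ 2 - 2 * N x * P' / P x ^ 3) x := by
  have h := hN.fun_div (hP.fun_pow 2) (pow_ne_zero 2 hP0)
  refine h.congr_deriv ?_
  simp only [show (2 : ℕ) - 1 = 1 from rfl, pow_one, Nat.cast_ofNat]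
  field_simp

/-- Quotient rule, shape `A / P² − 2 B C / P³` (the shape of `ψ₁` along a line). -/
theorem hasDerivAt_psi₁_shape {A B C P : ℝ → ℝ} {A' B' C' P' x : ℝ} (hA : HasDerivAt A A' x)
    (hB : HasDerivAt B B' x) (hC : HasDerivAt C C' x) (hP : HasDerivAt P P' x) (hP0 : P x ≠ 0) :
    HasDerivAt (fun t => A t / P t ^ 2 - 2 * B t * C t / P t ^ 3)
      (A' / P x ^ 2 - 2 * A x * P' / P x ^ 3 - 2 * (B' * C x + B x * C') / P x ^ 3
        + 6 * B x * C x * P' / P x ^ 4) x := by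
  have h1 := hasDerivAt_quot_sq hA hP hP0
  have h2 := (((hB.const_mul 2).mul hC).fun_div (hP.fun_pow 3) (pow_ne_zero 3 hP0))
  have h := h1.sub h2
  refine h.congr_deriv ?_
  simp only [Pi.mul_apply, show (3 : ℕ) - 1 = 2 from rfl, Nat.cast_ofNat]
  field_simp
  ring

/-- `hd1` of `radial_reduction` for `ψ = N / P²`: along every line, `psi` has derivative `psi₁`. -/
theorem FamilyData.hasDerivAt_psi_line (y u : E) (hpos : ∀ i ∈ D.s, D.c i + D.L i y ≠ 0)
    (hP : D.P y ≠ 0) : HasDerivAt (fun t : ℝ => D.psi (y + t • u)) (D.psi₁ y u) 0 := by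
  have hN : HasDerivAt (fun t : ℝ => D.N (y + t • u)) (D.dS 5 y u) 0 := by
    unfold FamilyData.N; exact (D.hasDerivAt_S_line 5 y u hpos).add_const _
  have hPl : HasDerivAt (fun t : ℝ => D.P (y + t • u)) (D.dS 2 y u) 0 := by
    unfold FamilyData.P; exact (D.hasDerivAt_S_line 2 y u hpos).add_const _
  have hP0 : (fun t : ℝ => D.P (y + t • u)) 0 ≠ 0 := by simpa using hP
  have h := hasDerivAt_quot_sq hN hPl hP0
  unfold FamilyData.psi FamilyData.psi₁
  refine h.congr_deriv ?_
  simp only [zero_smul, add_zero]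

/-- `hd2` of `radial_reduction` for `ψ = N / P²`: along every line, `psi₁ (·, u)` has derivative `psi₂`. -/
theorem FamilyData.hasDerivAt_psi₁_line (y u : E) (hpos : ∀ i ∈ D.s, D.c i + D.L i y ≠ 0)
    (hP : D.P y ≠ 0) : HasDerivAt (fun t : ℝ => D.psi₁ (y + t • u) u) (D.psi₂ y u) 0 := by
  have hA : HasDerivAt (fun t : ℝ => D.dS 5 (y + t • u) u) (D.ddS 5 y u) 0 :=
    D.hasDerivAt_dS_line 5 y u hpos
  have hB : HasDerivAt (fun t : ℝ => D.N (y + t • u)) (D.dS 5 y u) 0 := by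
    unfold FamilyData.N; exact (D.hasDerivAt_S_line 5 y u hpos).add_const _
  have hC : HasDerivAt (fun t : ℝ => D.dS 2 (y + t • u) u) (D.ddS 2 y u) 0 :=
    D.hasDerivAt_dS_line 2 y u hpos
  have hPl : HasDerivAt (fun t : ℝ => D.P (y + t • u)) (D.dS 2 y u) 0 := by
    unfold FamilyData.P; exact (D.hasDerivAt_S_line 2 y u hpos).add_const _
  have hP0 : (fun t : ℝ => D.P (y + t • u)) 0 ≠ 0 := by simpa using hP
  have h := hasDerivAt_psi₁_shape hA hB hC hPl hP0
  unfold FamilyData.psi₁ FamilyData.psi₂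
  refine h.congr_deriv ?_
  simp only [zero_smul, add_zero]
  ring

/-- COROLLARY: `radial_reduction` specialised to `ψ = (S₆ + F₆)/(S₃ + F₃)²` on a star-convex region on
which all family terms are positive and `P ≠ 0` — the exact shape of the Z2 table after the chart. -/
theorem FamilyData.radial_reduction {E : Type*} [NormedAddCommGroup E] [NormedSpace ℝ E] {ι : Type*}
    (D : FamilyData E ι) {K : Set E} {x₀ : E} {ρ m₀ η δ₀ b r₁ : ℝ} (hK : StarConvex ℝ x₀ K)
    (hpos : ∀ y ∈ K, ∀ i ∈ D.s, D.c i + D.L i y ≠ 0) (hP : ∀ y ∈ K, D.P y ≠ 0)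
    (hC : ∀ y ∈ K, ‖y - x₀‖ ≤ ρ → ∀ u : E, ‖u‖ = 1 → m₀ ≤ D.psi₂ y u)
    (hB : ∀ y ∈ K, ρ ≤ ‖y - x₀‖ →
      0 < D.psi₁ y (‖y - x₀‖⁻¹ • (y - x₀)) ∨ 0 < D.psi₂ y (‖y - x₀‖⁻¹ • (y - x₀)))
    (hG : ∀ u : E, ‖u‖ = 1 → -η ≤ D.psi₁ x₀ u) (h0 : b - δ₀ ≤ D.psi x₀)
    (hr₁ : 0 < r₁) (hrρ : r₁ ≤ ρ)
    (hq : ∀ t ∈ Icc r₁ ρ, δ₀ + η * t ≤ m₀ / 2 * t ^ 2) (hρη : η < m₀ * ρ) :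
    ∀ x ∈ K, r₁ ≤ ‖x - x₀‖ → b ≤ D.psi x :=
  OverbindingBudgetAffineRadialReduction.radial_reduction hK
    (fun y hy u => D.hasDerivAt_psi_line y u (hpos y hy) (hP y hy))
    (fun y hy u => D.hasDerivAt_psi₁_line y u (hpos y hy) (hP y hy)) hC hB hG h0 hr₁ hrρ hq hρη

end FamilySums

end Summit.AtomisticToContinuum.Crystallization.Theorems.OverbindingBudgetAffineRadialReduction
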